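import Summits.CriticalPhenomena.PercolationContinuityZ3.Theorems.PercNearOneGluingNoHeavyLowerTailSunflowerNuSpanBound
import HarnessLib
import HarnessLib.Audit

/-!
# `NoHeavyLowerTail` (crux stmt-CriticalPhenomena-4575), abstract sunflower cubic: the typed conjecture `NuMuSpanInequality` (NSI) — the
# rainbows are paid for by the spans of the CANONICAL kernel vectors of the cubes — and the reduction to ★

Support file (seat `prim-l12-p2` gen 24; `--supports stmt-CriticalPhenomena-4575`).  No `sorry`.  One new definition: the `@[conjecture]`
`NuMuSpanInequality` (an obligation of this programme — census-true, unproved —, never a fact).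
Memo: run/shared/lean/prim/prim-l12/prim-l12-p2/FINDING-g24-LOCAL-ASSIGNMENT.md (§6).

SETTING (`…SunflowerNuSpanBound`).  `ν_P` (`P ∈ P14(Lᶜ)`, bottom `L`) and `μ_Q` (`Q ∈ P30(Kᶜ)`, kernel `K`) are the canonical `(1|4)`- and
`(3|0)`-kernel vectors of the cubes; ★ reads `#rainbows ≤ Σ cubeSlack`, and `dim span{ν_P} ≤ cubeSlack Lᶜ`, `dim span{μ_Q} ≤ cubeSlack Kᶜ`.
* `NuMuSpanInequality` (NSI, typed conjecture, NEW):
      `#rainbows ≤ Σ_{lab L = 0} dim span{ν_P : P ∈ P14(Lᶜ)} + Σ_{lab K = 4} dim span{μ_Q : Q ∈ P30(Kᶜ)}`.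
  The weakest statement of the GF(2) programme found so far: RKI ⟹ RainbowMatroidPartition ⟹ LocalRainbowAssignment ⟹ NSI ⟹ ★ (the two-stage
  rainbow vectors restricted to a block are multiples of these ν's and μ's), and the first in which the rainbows enter only through their NUMBER
  `#rainbows = Σ_{P} #CR₂₃(Pᶜ)`.  Equivalent "relation-count" form: `Σ_{L∈B} e(Lᶜ) + Σ_{K∈A} e*(Kᶜ) ≤ Σ_P (#AB(Pᶜ) − #CR₂₃(Pᶜ)) + Σ_Q #AB(Qᶜ)`
  (`e` = number of independent ν-relations = even families of gen 23 §4; `P`, `Q` over petal-1 / petal-3 sets with kernel complement).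
  CENSUS (gen 24, `code/nuspan.c`; kit j148326, evidence on the item): n ≤ 5 EXHAUSTIVE — all 275 665 902 monotone maps `2^5 → M₃`, 2 890 800 with
  rainbows: 0 violations, 267 890 tight; random / 'hard' (all petals non-intersecting) sunflowers on 6, 7, 8 points: 176 223 + 160 000, 57 901 + 48 000,
  5 863 + 6 400 instances, 0 violations (≈ 30 % tight); ALL 654 052 compositions θ(4 points)∘gadgets on ≤ 7 points: 0 violations (83 078 tight); the cyclic
  star CS(3,3,3) (103 + 216 ≥ 217, both sides needed); on stars θ∘OR it is the identity `MA = #rainbows`, `NB = 0`.  The one-sided versions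
  `νspan + Σ_A cubeSlack ≥ #rb` and `Σ_B cubeSlack + μspan ≥ #rb` hold on the same census; the purely combinatorial rival-free count is NOT enough
  (fails in 3/6 766 sampled compositions).
* `partitionLemmaH_of_nuMuSpanInequality : NuMuSpanInequality → PartitionLemmaH` (`ZH_nonneg_of_nuMuSpan` for every sunflower).
-/

namespace Summit.CriticalPhenomena.PercolationContinuityZ3.Theorems.SunflowerPartition

open Finset

/-- **THE ν/μ-SPAN INEQUALITY** (NSI; this work; OPEN, census-clean — see the file header): for every sunflower, the number of rainbows is at
most the total dimension of the spans of the `(1|4)`-kernel vectors `ν_P` of its bottom cubes plus that of the `(3|0)`-kernel vectors `μ_Q` of its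
kernel cubes.  Implied by `LocalRainbowAssignment` / `RainbowMatroidPartition` / `RainbowKernelIndependence`; implies ★.  An obligation, never a
fact: use as `(h : NuMuSpanInequality)`. [status: open] -/
@[conjecture] def NuMuSpanInequality : Prop :=
  ∀ (α : Type) [Fintype α] [DecidableEq α] (F : Sunflower α),
    (F.rainbowCard : ℤ) ≤
      (∑ L ∈ (Finset.univ : Finset (Finset α)).filter (fun L => F.lab L = 0),
        (Module.finrank (ZMod 2) (Submodule.span (ZMod 2) (Set.range
          (fun P : ↥((Lᶜ).powerset.filter (fun P => F.lab P = 1 ∧ F.lab (Lᶜ \ P) = 4)) =>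
            fun σ : ↥(F.sup.filter (fun σ => σ.2 = L)) =>
              ∑ R ∈ (Lᶜ).powerset, (if F.lab R = 4 ∧ P.1 ⊆ R ∧ R ⊆ σ.1.1 then (1 : ZMod 2) else 0)))) : ℤ))
      + ∑ K ∈ (Finset.univ : Finset (Finset α)).filter (fun K => F.lab K = 4),
        (Module.finrank (ZMod 2) (Submodule.span (ZMod 2) (Set.range
          (fun Q : ↥((Kᶜ).powerset.filter (fun Q => F.lab Q = 3 ∧ F.lab (Kᶜ \ Q) = 0)) =>
            fun σ : ↥(F.sup.filter (fun σ => σ.2 = K)) =>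
              ∑ R' ∈ (Kᶜ).powerset, (if F.lab R' = 0 ∧ (σ.1.1 ∪ σ.1.2)ᶜ ⊆ R' ∧ R' ⊆ Q.1 then (1 : ZMod 2) else 0)))) : ℤ)

/-- **NSI ⟹ ★** (this work). [this work] -/
theorem partitionLemmaH_of_nuMuSpanInequality (h : NuMuSpanInequality) : PartitionLemmaH := by
  intro α _ _ F
  exact F.ZH_nonneg_of_nuMuSpan (h α F)

end Summit.CriticalPhenomena.PercolationContinuityZ3.Theorems.SunflowerPartition
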